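import Literature.AnabelianGeometry.AbsoluteAnabelian.MonoidKummerGaloisCyclotomeRestriction
import Literature.AnabelianGeometry.AbsoluteAnabelian.MLFGaloisMonoAnalyticModel
import Literature.NumberTheory.GaloisRepresentations.AbsGaloisGroupProofs
import Literature.NumberTheory.GaloisRepresentations.LocalGaloisGroupProofs
import HarnessLib

/-!
# The RESTRICTION MORPHISM `(G_E ↷ 𝒪_Ē^⊳) → (G_F ↷ 𝒪_F̄^⊳)` of a finite extension `E/F` of MLFs, and the
# unconditional naturality of the `μ_Ẑ(G)`-valued Kummer maps along it (non-vacuity of p446357)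

S. Mochizuki, *Topics in Absolute Anabelian Geometry III*, §3, Def. 3.1 (i)/(ii) p. 66–67 (the mono-analytic
model `(G_k ↷ 𝒪_k̄^⊳)`; morphisms «induce an open injective homomorphism between the respective arithmetic
Galois groups»), Prop. 3.2 (ii) p. 71–72, Rmk. 3.2.1 p. 73 (bib key `MochizukiAbsTopIII2015`); [AbsAnab] Prop.
1.2.1 (vi)/(vii) pp. 10–11 (bib key `MochizukiAbsAnab2004`).

THE POINT (abc-iut cell, layer L4, row «P32ii-MUZHAT-HOM-NAT», non-vacuity / «RES-WITNESS» of abc-iut-L4-t2's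
`MonoidKummerGaloisCyclotomeRestriction.lean`, p446357).  For a finite extension `E/F` of non-archimedean local
fields of characteristic `0` whose valuation prolongs (`[ValuativeExtension F E]`, abc-iut-L4-t11's setting) we
CONSTRUCT print's basic morphism of Def. 3.1 (ii) between the mono-analytic models on Mathlib's algebraic closures
(`MLFClosure.ofAlgClosure`, `ModelMLFGaloisData.galois`):

* `restrictHom F E : (G_E ↷ 𝒪_Ē^⊳) → (G_F ↷ 𝒪_F̄^⊳)` — Galois component = abc-iut's `absGaloisRestrict F E`
  (Literature/NumberTheory; continuous, injective, open image), object component = `j = ι⁻¹ : Ē ≃ F̄` on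
  `𝒪^⊳` (`absClosureEquiv`; integrality is preserved: `absClosureEmbedding_mem_absIntegers_iff`, spectral
  norms agree); `comap_ker` / `isOpen_image` checked (the arithmetic kernels of mono-analytic models are
  trivial; the image of an open subgroup under an open embedding is open);
* `restrictHom_haug`, `restrictHom_hφM` — it IS a restriction morphism along `j` in the sense of p446357;
* **`pullMuZhat_kummerMuZhat_eq_pushMuZhat_restrictHom`** — HYPOTHESIS-FREE instance of [AbsTopIII] Prop. 3.2
  (ii) with Rmk. 3.2.1 coefficients along the restriction `G_E ↪ G_F`: `res^* κ^G_{H₂}(j m) = μ_Ẑ(res)_* κ^G_{H₁}(m)`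
  for THE reciprocity data, every open `H₁ ⊆ G_E`, `H₂ ⊆ G_F` with `res(H₁) ⊆ H₂`, every `m ∈ (𝒪_Ē^⊳)^{H₁}`.

Small DATA definitions (`MLFClosure.ofAlgClosure`, `restrictHomM`, `restrictHom`); no `Prop`-valued definition,
no instance.  Universe `0`.  HONEST FRAMING: classical; nothing here bears on [IUTchIII] Cor. 3.12; no side is
taken; nothing asserts that abc is proved or refuted.
-/

noncomputable section

namespace Literature.AnabelianGeometry.AbsoluteAnabelian

open _root_.ValuativeRel Field
open Literature.NumberTheory.GaloisRepresentations

/-! ### §1 The closure datum on Mathlib's algebraic closure -/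

/-- **The closure datum `(k, k^alg)`** on Mathlib's `AlgebraicClosure k` (an `abbrev`, so that the instances of
`k` are the instances of `(ofAlgClosure k).k`). [cite: MochizukiAbsTopIII2015, Definition 3.1 (i) p.66] -/
abbrev MLFClosure.ofAlgClosure (k : Type) [Field k] [ValuativeRel k] [TopologicalSpace k]
    [IsNonarchimedeanLocalField k] [CharZero k] : MLFClosure.{0} where
  k := k
  K := AlgebraicClosure k

section Witness

variable (F E : Type) [Field F] [ValuativeRel F] [TopologicalSpace F] [IsNonarchimedeanLocalField F] [CharZero F]
  [Field E] [ValuativeRel E] [TopologicalSpace E] [IsNonarchimedeanLocalField E] [CharZero E]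
  [Algebra F E] [FiniteDimensional F E] [ValuativeExtension F E]

/-! ### §2 The object component `j = ι⁻¹ : 𝒪_Ē^⊳ → 𝒪_F̄^⊳` -/

omit [CharZero E] in
/-- `j = ι⁻¹ : Ē ≃ F̄` preserves integrality: `j x ∈ 𝒪_F̄^⊳` for `x ∈ 𝒪_Ē^⊳` (the spectral norms over `F` and
over `E` agree, `absClosureEmbedding_mem_absIntegers_iff`). [cite: MochizukiAbsTopIII2015, Definition 3.1 (i) p.66] -/
theorem absClosureEquiv_symm_mem_nonzeroIntegers (x : nonzeroIntegers E (AlgebraicClosure E)) :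
    (absClosureEquiv F E).symm (x : AlgebraicClosure E) ∈ nonzeroIntegers F (AlgebraicClosure F) := by
  refine ⟨?_, (map_ne_zero _).mpr x.2.2⟩
  have hx : absClosureEmbedding F E ((absClosureEquiv F E).symm (x : AlgebraicClosure E)) ∈ absIntegers 𝒪[E] E := by
    rw [absClosureEmbedding_absClosureEquiv_symm]
    exact x.2.1
  exact (absClosureEmbedding_mem_absIntegers_iff (F := F) (E := E) _).mp hx

/-- **The object component `φ_M = j|_{𝒪^⊳} : 𝒪_Ē^⊳ → 𝒪_F̄^⊳`** of the restriction morphism.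
[cite: MochizukiAbsTopIII2015, Definition 3.1 (ii) p.67] -/
def restrictHomM : nonzeroIntegers E (AlgebraicClosure E) →* nonzeroIntegers F (AlgebraicClosure F) where
  toFun x := ⟨(absClosureEquiv F E).symm (x : AlgebraicClosure E), absClosureEquiv_symm_mem_nonzeroIntegers F E x⟩
  map_one' := Subtype.ext (by
    change (absClosureEquiv F E).symm ((1 : nonzeroIntegers E (AlgebraicClosure E)) : AlgebraicClosure E) = 1
    rw [OneMemClass.coe_one, map_one])
  map_mul' x y := Subtype.ext (by
    change (absClosureEquiv F E).symm ((x * y : nonzeroIntegers E (AlgebraicClosure E)) : AlgebraicClosure E) =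
      (absClosureEquiv F E).symm (x : AlgebraicClosure E) * (absClosureEquiv F E).symm (y : AlgebraicClosure E)
    rw [Submonoid.coe_mul, map_mul])

omit [CharZero E] in
/-- Values of `restrictHomM`: `j x`. [cite: MochizukiAbsTopIII2015, Definition 3.1 (ii) p.67] -/
@[simp] theorem coe_restrictHomM_apply (x : nonzeroIntegers E (AlgebraicClosure E)) :
    ((restrictHomM F E x : nonzeroIntegers F (AlgebraicClosure F)) : AlgebraicClosure F) =
      (absClosureEquiv F E).symm (x : AlgebraicClosure E) := rfl

omit [ValuativeRel F] [TopologicalSpace F] [IsNonarchimedeanLocalField F] [ValuativeRel E]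
  [TopologicalSpace E] [IsNonarchimedeanLocalField E] [CharZero E] [ValuativeExtension F E] in
/-- `res σ` acts on `j x` as `j (σ x)`: `(res σ) (j x) = j (σ x)` (`absGaloisRestrict_apply_smul` read through
`j = ι⁻¹`). [cite: MochizukiAbsTopIII2015, Definition 3.1 (ii) p.67] -/
theorem absGaloisRestrict_smul_absClosureEquiv_symm (σ : absoluteGaloisGroup E) (x : AlgebraicClosure E) :
    absGaloisRestrict F E σ • (absClosureEquiv F E).symm x = (absClosureEquiv F E).symm (σ • x) := by
  apply (absClosureEquiv F E).injective
  rw [absClosureEquiv_apply, absGaloisRestrict_apply_smul, AlgEquiv.apply_symm_apply, ← absClosureEquiv_apply,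
    AlgEquiv.apply_symm_apply]

/-! ### §3 The restriction morphism of the mono-analytic models -/

omit [ValuativeRel F] [TopologicalSpace F] [IsNonarchimedeanLocalField F] [ValuativeRel E] [TopologicalSpace E]
  [IsNonarchimedeanLocalField E] [ValuativeExtension F E] in
/-- The image of an open subgroup under `res : G_E ↪ G_F` is open (an open embedding: injective with open
image between compact Hausdorff groups). [cite: MochizukiAbsTopIII2015, Definition 3.1 (ii) p.67] -/
theorem isOpen_map_absGaloisRestrict (U : Subgroup (absoluteGaloisGroup E)) (hU : IsOpen (U : Set (absoluteGaloisGroup E))) :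
    IsOpen ((U.map (absGaloisRestrict F E : absoluteGaloisGroup E →* absoluteGaloisGroup F)) :
      Set (absoluteGaloisGroup F)) := by
  have heq : ((U.map (absGaloisRestrict F E : absoluteGaloisGroup E →* absoluteGaloisGroup F)) :
        Set (absoluteGaloisGroup F)) =
      (osMap (rangeOpenSubgroup (absGaloisRestrict F E) (isOpen_range_absGaloisRestrict F E))
        (imageOpenSubgroup (equivRangeOfInjective (absGaloisRestrict F E) (absGaloisRestrict_injective F E)
          (isOpen_range_absGaloisRestrict F E)) ⟨U, hU⟩) : Set (absoluteGaloisGroup F)) := by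
    ext g
    rw [SetLike.mem_coe, Subgroup.mem_map, SetLike.mem_coe, mem_osMap_imageOpenSubgroup_equivRange_iff]
    rfl
  rw [heq]
  exact OpenSubgroup.isOpen _

/-- `res : G_E → G_F` between the automorphism groups of the algebraic closures (the types of the mono-analytic
models; abc-iut's `absGaloisRestrict F E`). [cite: MochizukiAbsTopIII2015, Definition 3.1 (ii) p.67] -/
def resHom : (AlgebraicClosure E ≃ₐ[E] AlgebraicClosure E) →* (AlgebraicClosure F ≃ₐ[F] AlgebraicClosure F) where
  toFun σ := absGaloisRestrict F E σ
  map_one' := map_one (absGaloisRestrict F E)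
  map_mul' σ τ := map_mul (absGaloisRestrict F E) σ τ

omit [ValuativeRel F] [TopologicalSpace F] [IsNonarchimedeanLocalField F] [CharZero F] [ValuativeRel E]
  [TopologicalSpace E] [IsNonarchimedeanLocalField E] [CharZero E] [FiniteDimensional F E] [ValuativeExtension F E] in
/-- `resHom σ = absGaloisRestrict F E σ`. [cite: MochizukiAbsTopIII2015, Definition 3.1 (ii) p.67] -/
@[simp] theorem resHom_apply (σ : AlgebraicClosure E ≃ₐ[E] AlgebraicClosure E) :
    resHom F E σ = absGaloisRestrict F E σ := rfl

/-- The arithmetic kernel of the mono-analytic model is trivial (`G_k` acts faithfully on `𝒪_k̄^⊳`).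
[cite: MochizukiAbsTopIII2015, Definition 3.1 (ii) p.67] -/
theorem galois_tmPair_actionKer_eq_bot (k : Type) [Field k] [ValuativeRel k] [TopologicalSpace k]
    [IsNonarchimedeanLocalField k] [CharZero k] :
    (ModelMLFGaloisData.galois k (AlgebraicClosure k)).tmPair.actionKer = ⊥ := by
  rw [ModelMLFGaloisData.tmPair_actionKer (MLFClosure.ofAlgClosure k) (ModelMLFGaloisData.galois k (AlgebraicClosure k))]
  exact MonoidHom.ker_id

/-- **The restriction morphism `(G_E ↷ 𝒪_Ē^⊳) → (G_F ↷ 𝒪_F̄^⊳)`** of the mono-analytic models of a finite extension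
`E/F` of MLFs (print's basic morphism of Def. 3.1 (ii): Galois component `res : G_E ↪ G_F`, an open injection;
object component `j = ι⁻¹` on `𝒪^⊳`). [cite: MochizukiAbsTopIII2015, Definition 3.1 (ii) p.67] -/
def restrictHom :
    GaloisMonoidPair.Hom (ModelMLFGaloisData.galois E (AlgebraicClosure E)).tmPair
      (ModelMLFGaloisData.galois F (AlgebraicClosure F)).tmPair where
  homPi := resHom F E
  continuous_homPi := (absGaloisRestrict F E).continuous
  homM := restrictHomM F E
  smul_comm g x := Subtype.ext (by
    rw [coe_restrictHomM_apply, ModelMLFGaloisData.nonzeroIntegers_coe_smul,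
      ModelMLFGaloisData.nonzeroIntegers_coe_smul, coe_restrictHomM_apply, ModelMLFGaloisData.galois_aug_apply,
      ModelMLFGaloisData.galois_aug_apply]
    exact (absGaloisRestrict_smul_absClosureEquiv_symm F E g (x : AlgebraicClosure E)).symm)
  comap_ker := by
    rw [galois_tmPair_actionKer_eq_bot, galois_tmPair_actionKer_eq_bot, MonoidHom.comap_bot, MonoidHom.ker_eq_bot_iff]
    exact absGaloisRestrict_injective F E
  isOpen_image U hU := by
    rw [galois_tmPair_actionKer_eq_bot, sup_bot_eq]
    exact isOpen_map_absGaloisRestrict F E U hU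

/-- `restrictHom` is a restriction morphism along `j` (the Galois clause `haug` of p446357): `(res g) (j x) = j (g x)`.
[cite: MochizukiAbsTopIII2015, Definition 3.1 (ii) p.67] -/
theorem restrictHom_haug (g : (ModelMLFGaloisData.galois E (AlgebraicClosure E)).Pi) (x : AlgebraicClosure E) :
    (ModelMLFGaloisData.galois F (AlgebraicClosure F)).aug ((restrictHom F E).homPi g) ((absClosureEquiv F E).symm x) =
      (absClosureEquiv F E).symm ((ModelMLFGaloisData.galois E (AlgebraicClosure E)).aug g x) :=
  absGaloisRestrict_smul_absClosureEquiv_symm F E g x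

/-- `restrictHom` is a restriction morphism along `j` (the object clause `hφM` of p446357): `φ_M m = j m`.
[cite: MochizukiAbsTopIII2015, Definition 3.1 (ii) p.67] -/
theorem restrictHom_hφM (m : nonzeroIntegers E (AlgebraicClosure E)) :
    (((restrictHom F E).homM m : nonzeroIntegers F (AlgebraicClosure F)) : AlgebraicClosure F) =
      (absClosureEquiv F E).symm (m : AlgebraicClosure E) := rfl

/-! ### §4 Hypothesis-free naturality along `restrictHom` -/

/-- **[AbsTopIII] Prop 3.2 (ii) with `μ_Ẑ(G)`-coefficients along the restriction `G_E ↪ G_F`, HYPOTHESIS-FREE**: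
for THE reciprocity data, every open `H₁ ⊆ G_E`, `H₂ ⊆ G_F` with `res(H₁) ⊆ H₂` and every `m ∈ (𝒪_Ē^⊳)^{H₁}`,
`res^* (κ^G_{H₂}(j m)) = μ_Ẑ(res)_* (κ^G_{H₁}(m))` — the instance of abc-iut-L4-t2's
`pullMuZhat_kummerMuZhat_eq_pushMuZhat_restrict` (p446357) at the restriction morphism of the mono-analytic
models; in particular p446357's hypotheses are inhabited by a genuine `E ⊋ F`.
[cite: MochizukiAbsTopIII2015, Proposition 3.2 (ii) p.72] -/
theorem pullMuZhat_kummerMuZhat_eq_pushMuZhat_restrictHom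
    {H₁ : OpenSubgroup (ModelMLFGaloisData.galois E (AlgebraicClosure E)).tmPair.Pi}
    {H₂ : OpenSubgroup (ModelMLFGaloisData.galois F (AlgebraicClosure F)).tmPair.Pi}
    (hH : (H₁ : Subgroup (ModelMLFGaloisData.galois E (AlgebraicClosure E)).Pi).map (restrictHom F E).homPi ≤
      (H₂ : Subgroup (ModelMLFGaloisData.galois F (AlgebraicClosure F)).Pi))
    (m : {m : (ModelMLFGaloisData.galois E (AlgebraicClosure E)).tmPair.M //
      ∀ h : H₁, (h : (ModelMLFGaloisData.galois E (AlgebraicClosure E)).tmPair.Pi) • m = m})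
    (hm : ∀ h : H₂, (h : (ModelMLFGaloisData.galois F (AlgebraicClosure F)).tmPair.Pi) • (restrictHom F E).homM m.1 =
      (restrictHom F E).homM m.1) :
    (restrictHom F E).pullMuZhat (C₁ := MLFClosure.ofAlgClosure E) (C₂ := MLFClosure.ofAlgClosure F)
        (TorsionReciprocityData.fundamental F) hH
        (ModelMLFGaloisData.kummerMuZhat (MLFClosure.ofAlgClosure F) (ModelMLFGaloisData.galois F (AlgebraicClosure F))
          (TorsionReciprocityData.fundamental F) H₂ ⟨(restrictHom F E).homM m.1, hm⟩) =
      (restrictHom F E).pushMuZhat (C₁ := MLFClosure.ofAlgClosure E) (C₂ := MLFClosure.ofAlgClosure F)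
        (ModelMLFGaloisData.galois_aug_isOpenMap E (AlgebraicClosure E))
        (ModelMLFGaloisData.galois_aug_isOpenMap F (AlgebraicClosure F))
        (TorsionReciprocityData.fundamental E) (TorsionReciprocityData.fundamental F) hH
        (ModelMLFGaloisData.kummerMuZhat (MLFClosure.ofAlgClosure E) (ModelMLFGaloisData.galois E (AlgebraicClosure E))
          (TorsionReciprocityData.fundamental E) H₁ m) :=
  GaloisMonoidPair.Hom.pullMuZhat_kummerMuZhat_eq_pushMuZhat_restrict (C₁ := MLFClosure.ofAlgClosure E)
    (C₂ := MLFClosure.ofAlgClosure F) ((absClosureEquiv F E).symm) (restrictHom F E) (restrictHom_haug F E)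
    (restrictHom_hφM F E) _ _ hH m hm

end Witness

end Literature.AnabelianGeometry.AbsoluteAnabelian

end
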